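import Literature.NumberTheory.GaloisRepresentations.CompletionCompositum
import Literature.NumberTheory.GaloisRepresentations.ChebotarevCosetCyclotomic
import Literature.NumberTheory.GaloisRepresentations.DecompositionGroupOfCompletion
import Literature.NumberTheory.GaloisRepresentations.IntegralGaloisActionProofs
import HarnessLib

/-!
# Pushing local conditions down a finite Galois extension; Frobenius elements in local groups

Topic `NumberTheory/GaloisRepresentations`; theorems only (no definition, no named fact).  Two
inputs for assembling Clozel–Harris–Taylor, Lemma 4.1.2 over the maximal totally real subfield:

* `exists_openNormal_forall_absGaloisRestrict_mem` — for a finite Galois extension of number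
  fields `E/K`, places `w ∣ v` and an open subgroup `U ≤ Γ_{E_w}`, there is an open normal
  subgroup `N ≤ Γ_{K_v}` with `res⁻¹(N) ⊆ U` for the restriction `res : Γ_{E_w} → Γ_{K_v}` along
  `K_v → E_w` (`res` is a closed embedding: `E_w/K_v` is finite, `SemiLocal.finiteDimensional_place`,
  so `res` is injective, `absGaloisRestrict_injective`, and continuous from a compact space).
* `exists_conj_absGaloisRestrict_mul_inv_mem` — **every element of `Γ_K` is, modulo a given open
  normal subgroup `C` and up to `Γ_K`-conjugacy, in the image of some local Galois group
  `Γ_{K_v}`, `v` outside any finite set** (Chebotarev in the existence form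
  `infinite_setOf_prime_absNorm_frobenius_mul_inv_mem`, conjugacy of the primes of `\bar ℤ_K`
  above `v`, and `D_{𝔓₀} = res Γ_{K_v}`, `decompositionSubgroup_adicCompletionPrime_eq_range`).

## References

* J. Neukirch, *Algebraic Number Theory*, Ch. II (8.1)–(8.3), §9 (9.6), Ch. VII (13.4).
  [cite: NeukirchANT1999, Ch. II §9 Prop. (9.6)]
* J. Tate, *Global class field theory*, Cassels–Fröhlich Ch. VII §2.4. [cite: TateGCFT1967, §2.4]
-/

noncomputable section

open scoped NumberField Valued Pointwise
open Field IsDedekindDomain NumberField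
open Literature.NumberTheory.Automorphic

namespace Literature.NumberTheory.GaloisRepresentations

/-- **Pushdown of an open subgroup.**  See the module docstring.
[cite: NeukirchANT1999, Ch. II §9 Prop. (9.6)] -/
theorem exists_openNormal_forall_absGaloisRestrict_mem {K E : Type} [Field K] [NumberField K]
    [Field E] [NumberField E] [Algebra K E] [IsGalois K E] (v : HeightOneSpectrum (𝓞 K))
    (w : HeightOneSpectrum (𝓞 E)) [hw : w.asIdeal.LiesOver v.asIdeal]
    (U : OpenSubgroup (absoluteGaloisGroup (w.adicCompletion E))) :
    letI := (adicCompletionOfLiesOver K E v w).toAlgebra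
    ∃ N : Subgroup (absoluteGaloisGroup (v.adicCompletion K)), N.Normal ∧
      IsOpen (N : Set (absoluteGaloisGroup (v.adicCompletion K))) ∧
      ∀ a : absoluteGaloisGroup (w.adicCompletion E),
        absGaloisRestrict (v.adicCompletion K) (w.adicCompletion E) a ∈ N → a ∈ U := by
  letI := (adicCompletionOfLiesOver K E v w).toAlgebra
  haveI : CharZero (v.adicCompletion K) :=
    charZero_of_injective_algebraMap (algebraMap K _).injective
  haveI : CharZero (w.adicCompletion E) :=
    charZero_of_injective_algebraMap (algebraMap E _).injective
  have hwv : w.under (𝓞 K) = v := HeightOneSpectrum.ext hw.over.symm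
  haveI : FiniteDimensional (v.adicCompletion K) (w.adicCompletion E) :=
    SemiLocal.finiteDimensional_place (K := K) (E := E) (v := v) ⟨w, hwv⟩
  set r := absGaloisRestrict (v.adicCompletion K) (w.adicCompletion E) with hr
  have hcont : Continuous r := r.continuous_toFun
  have hinj : Function.Injective r :=
    absGaloisRestrict_injective (v.adicCompletion K) (w.adicCompletion E)
  have hemb : Topology.IsClosedEmbedding r := hcont.isClosedEmbedding hinj
  obtain ⟨O, hO, hpre⟩ := hemb.isInducing.isOpen_iff.1 U.isOpen
  have h1 : (1 : absoluteGaloisGroup (v.adicCompletion K)) ∈ O := by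
    have h : (1 : absoluteGaloisGroup (w.adicCompletion E)) ∈ r ⁻¹' O := by
      rw [hpre]; exact U.one_mem
    simpa [Set.mem_preimage, map_one] using h
  obtain ⟨N, hN⟩ := ProfiniteGrp.exist_openNormalSubgroup_sub_open_nhds_of_one hO h1
  refine ⟨(N : Subgroup (absoluteGaloisGroup (v.adicCompletion K))), N.isNormal', N.isOpen',
    fun a ha => ?_⟩
  have h2 : a ∈ r ⁻¹' O := hN ha
  rw [hpre] at h2
  exact h2

set_option synthInstance.maxHeartbeats 200000 in
/-- **Frobenius elements in local groups.**  See the module docstring.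
[cite: TateGCFT1967, §2.4] [cite: NeukirchANT1999, Ch. II §9 Prop. (9.6)] -/
theorem exists_conj_absGaloisRestrict_mul_inv_mem {K : Type} [Field K] [NumberField K]
    (C : Subgroup (absoluteGaloisGroup K)) [C.Normal] (hC : IsOpen (C : Set (absoluteGaloisGroup K)))
    (y : absoluteGaloisGroup K) (T : Finset (HeightOneSpectrum (𝓞 K))) :
    ∃ v ∉ T, ∃ (σ : absoluteGaloisGroup (v.adicCompletion K)) (γ : absoluteGaloisGroup K),
      γ⁻¹ * absGaloisRestrict K (v.adicCompletion K) σ * γ * y⁻¹ ∈ C := by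
  classical
  obtain ⟨v, hv, hvT⟩ :=
    (infinite_setOf_prime_absNorm_frobenius_mul_inv_mem C hC y).exists_notMem_finset T
  obtain ⟨-, -, 𝔓, h𝔓, Φ, hΦ, hΦy⟩ := hv
  haveI := h𝔓.1
  have hstab : Φ • 𝔓 = 𝔓 := hΦ.mem_stabilizer
  obtain ⟨γ, hγ⟩ := HeightOneSpectrum.exists_smul_eq_of_mem_primesAbove_holds (K := K) (v := v) h𝔓
    (adicCompletionPrime_mem_primesAbove K v)
  have hmem : γ * Φ * γ⁻¹ ∈
      (adicCompletionPrime K v).decompositionSubgroup (absoluteGaloisGroup K) := by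
    rw [Ideal.mem_decompositionSubgroup_iff, ← hγ, smul_smul, inv_mul_cancel_right, mul_smul, hstab]
  rw [decompositionSubgroup_adicCompletionPrime_eq_range] at hmem
  obtain ⟨σ, hσ⟩ := hmem
  refine ⟨v, hvT, σ, γ, ?_⟩
  have h1 : absGaloisRestrict K (v.adicCompletion K) σ = γ * Φ * γ⁻¹ := hσ
  rw [h1]
  have h2 : γ⁻¹ * (γ * Φ * γ⁻¹) * γ * y⁻¹ = Φ * y⁻¹ := by group
  rw [h2]
  exact hΦy

end Literature.NumberTheory.GaloisRepresentations
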